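import Literature.Analysis.FluidPDE.TsaiProfileEndgame
import HarnessLib

/-!
# Route CorkscrewDynamo · crux `CorkscrewProfile` (stmt-NavierStokesRegularity-11282) — tool stub T3: the rotation-gauged head pressure identity `νΔΠ_A − DΠ_A[U + a y − A y] = (ν/2)|DU − DUᵀ|² + 2ν tr (A ∘ DU)`

Tool stub `stub_rotatedHeadIdentity` of line `registered` (skeleton v10, lead c5): for a solution
`(U, P)` (`U ∈ C³`, `P ∈ C²`, `div U = 0`) of the rotated Leray profile system
`−νΔU + aU + aDU[y] + (A U − DU[A y]) + DU[U] + ∇P = 0` on a finite-dimensional real inner product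
space `E`, with `A : E →L[ℝ] E` skew (`⟪A v, w⟫ = −⟪v, A w⟫`; on `ℝ³`, `A = α·(e₃ × ·)`) and the
pressure Poisson equation `ΔP = −tr (DU ∘ DU)` assumed, the rotation-gauged head pressure
`Π_A(z) = ½|U|² + P + a ⟪z, U⟫ − ⟪A z, U z⟫` satisfies, for the co-rotating drift
`b = U y + a y − A y` of Tsai's drift operator `driftOp ν a (U − A)`,
`ν ΔΠ_A − DΠ_A[b] = (ν/2) |DU − DUᵀ|² + 2ν tr (A ∘ DU)`. This is the case `A ≠ 0` of
`IsLerayProfile.driftOp_headPressure_eq_spin` (Tsai 1998, (1.7)): `Δ⟪A·, U·⟫ = ⟪A y, ΔU⟫ − 2 tr (A ∘ DU)`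
by skewness, `DΠ_A[v] = ⟪b, DU v⟫ + DP v + a⟪v, U⟫ − ⟪A v, U⟫`, and pairing the system
`−νΔU + aU + A U + DU[b] + ∇P = 0` with `b` gives `DΠ_A[b] = ν ⟪ΔU, b⟫`.
-/

noncomputable section

open MeasureTheory Set Function Filter Topology InnerProductSpace Metric
open Literature.Analysis.FluidPDE
open scoped RealInnerProductSpace Laplacian ContDiff NNReal ENNReal

namespace Summit.NavierStokesRegularity.NavierStokesRegularity.Theorems.CorkscrewProfile.Birth

set_option linter.dupNamespace false

variable {E : Type*} [NormedAddCommGroup E] [InnerProductSpace ℝ E] [FiniteDimensional ℝ E]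

/-- The Laplacian of a continuous linear map vanishes: `Δ A = 0`. [folklore] -/
private theorem laplacian_clm_eq_zero (A : E →L[ℝ] E) (x : E) : (Δ (A : E → E)) x = 0 := by
  rw [laplacian_eq_sum_fderiv_fderiv (stdOrthonormalBasis ℝ E) A.contDiff x]
  simp [ContinuousLinearMap.fderiv]

/-- For a skew `A`, `Σᵢ ⟪A bᵢ, L bᵢ⟫ = −tr (A ∘ L)` over an orthonormal basis `b`. [folklore] -/
private theorem sum_inner_skew_apply_eq_neg_traceCLM {ι : Type*} [Fintype ι]
    (b : OrthonormalBasis ι ℝ E) (A L : E →L[ℝ] E) (hA : ∀ v w : E, ⟪A v, w⟫ = -⟪v, A w⟫) :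
    ∑ i, ⟪A (b i), L (b i)⟫ = -traceCLM (A.comp L) := by
  rw [traceCLM_eq_sum_inner b, ← Finset.sum_neg_distrib]
  refine Finset.sum_congr rfl fun i _ => ?_
  rw [ContinuousLinearMap.comp_apply]
  exact hA _ _

/-- **The rotation-gauged head pressure identity.** For a solution `(U, P)` (`U ∈ C³`, `P ∈ C²`,
`div U = 0`) of the rotated Leray profile system
`−νΔU + aU + aDU[y] + (A U − DU[A y]) + DU[U] + ∇P = 0` with `A` skew, satisfying the pressure
Poisson equation `ΔP = −tr (DU ∘ DU)`, the gauged head pressure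
`Π_A = ½|U|² + P + a⟪·, U⟫ − ⟪A ·, U⟫` obeys
`ν ΔΠ_A − DΠ_A[U + a y − A y] = (ν/2) |DU − DUᵀ|² + 2ν tr (A ∘ DU)`
(the case `A = 0` is Tsai 1998, (1.7), `IsLerayProfile.driftOp_headPressure_eq_spin`).
[cite: Tsai1998, (1.7) (p. 31)] -/
theorem stub_rotatedHeadIdentity {ν a : ℝ} {U : E → E} {P : E → ℝ} (A : E →L[ℝ] E)
    (hA : ∀ v w : E, ⟪A v, w⟫ = -⟪v, A w⟫)
    (hU3 : ContDiff ℝ 3 U) (hP2 : ContDiff ℝ 2 P) (hdiv : VectorCalculus.IsDivFree U)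
    (heq : ∀ y, -(ν • (Δ U) y) + a • U y + a • fderiv ℝ U y y + (A (U y) - fderiv ℝ U y (A y)) +
      convect U U y + gradient P y = 0)
    (hΔP : ∀ y, (Δ P) y = -traceCLM ((fderiv ℝ U y).comp (fderiv ℝ U y)))
    (y : E) :
    driftOp ν a (fun z => U z - A z) (fun z => headPressure a U P z - ⟪A z, U z⟫) y =
      ν / 2 * frobeniusNormSq (spin U y) + 2 * ν * traceCLM (A.comp (fderiv ℝ U y)) := by
  haveI : CompleteSpace E := FiniteDimensional.complete ℝ E
  have hU2 : ContDiff ℝ 2 U := hU3.of_le (by norm_num)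
  have hU1 : ContDiff ℝ 1 U := hU3.of_le (by norm_num)
  have hP1 : ContDiff ℝ 1 P := hP2.of_le one_le_two
  have hUd : Differentiable ℝ U := hU1.differentiable one_ne_zero
  have hPd : Differentiable ℝ P := hP1.differentiable one_ne_zero
  have hHd : Differentiable ℝ (headPressure a U P) :=
    (contDiff_headPressure hU1 hP1).differentiable one_ne_zero
  set b := stdOrthonormalBasis ℝ E with hb
  -- the rotation term of `ΔΠ_A`
  have hS : ∑ i, ⟪A (b i), fderiv ℝ U y (b i)⟫ = -traceCLM (A.comp (fderiv ℝ U y)) :=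
    sum_inner_skew_apply_eq_neg_traceCLM b A _ hA
  -- the Laplacian of the gauged head pressure
  have hLap : (Δ fun z => headPressure a U P z - ⟪A z, U z⟫) y =
      ⟪(Δ U) y, U y⟫ + frobeniusNormSq (fderiv ℝ U y) + (Δ P) y +
        a * (⟪y, (Δ U) y⟫ + 2 * VectorCalculus.divergence U y) -
        (⟪A y, (Δ U) y⟫ + 2 * ∑ i, ⟪A (b i), fderiv ℝ U y (b i)⟫) := by
    have hfun : (fun z => headPressure a U P z - ⟪A z, U z⟫) =
        headPressure a U P - fun z => ⟪A z, U z⟫ := rfl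
    rw [hfun, (contDiff_headPressure hU2 hP2).contDiffAt.laplacian_sub
      (A.contDiff.inner ℝ hU2).contDiffAt, laplacian_headPressure hU2 hP2 y,
      laplacian_inner_eq b A.contDiff hU2 y, laplacian_clm_eq_zero A y, inner_zero_left, zero_add]
    simp only [ContinuousLinearMap.fderiv]
  -- the derivative of the gauged head pressure
  have hDer : ∀ w, fderiv ℝ (fun z => headPressure a U P z - ⟪A z, U z⟫) y w =
      ⟪U y, fderiv ℝ U y w⟫ + fderiv ℝ P y w + a * (⟪w, U y⟫ + ⟪y, fderiv ℝ U y w⟫) -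
        (⟪A y, fderiv ℝ U y w⟫ + ⟪A w, U y⟫) := by
    intro w
    rw [fderiv_fun_sub (hHd y) (A.differentiableAt.inner ℝ (hUd y)), _root_.sub_apply,
      fderiv_headPressure_apply hUd hPd y w, fderiv_inner_apply ℝ A.differentiableAt (hUd y),
      ContinuousLinearMap.fderiv]
  -- `|DU − DUᵀ|² = 2 (|DU|² − tr (DU ∘ DU))`
  have hspin : frobeniusNormSq (spin U y) =
      2 * (frobeniusNormSq (fderiv ℝ U y) - traceCLM ((fderiv ℝ U y).comp (fderiv ℝ U y))) :=
    frobeniusNormSq_sub_adjoint _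
  -- the system paired with `U y`, `y` and `A y`
  have hEU : ⟪-(ν • (Δ U) y) + a • U y + a • fderiv ℝ U y y + (A (U y) - fderiv ℝ U y (A y)) +
      convect U U y + gradient P y, U y⟫ = 0 := by
    rw [heq y, inner_zero_left]
  have hEy : ⟪-(ν • (Δ U) y) + a • U y + a • fderiv ℝ U y y + (A (U y) - fderiv ℝ U y (A y)) +
      convect U U y + gradient P y, y⟫ = 0 := by
    rw [heq y, inner_zero_left]
  have hEAy : ⟪-(ν • (Δ U) y) + a • U y + a • fderiv ℝ U y y + (A (U y) - fderiv ℝ U y (A y)) +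
      convect U U y + gradient P y, A y⟫ = 0 := by
    rw [heq y, inner_zero_left]
  simp only [inner_add_left, inner_sub_left, inner_neg_left, real_inner_smul_left, convect_apply,
    gradient, InnerProductSpace.toDual_symm_apply] at hEU hEy hEAy
  -- skew-symmetry of `A`
  have h1 : ⟪A (U y), U y⟫ = 0 := by
    have h := hA (U y) (U y)
    rw [real_inner_comm (A (U y)) (U y)] at h
    linarith
  have h2 : ⟪A (U y), y⟫ = -⟪A y, U y⟫ := by
    rw [hA (U y) y, real_inner_comm (A y) (U y)]
  have h3 : ⟪A (U y), A y⟫ = -⟪A (A y), U y⟫ := by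
    rw [hA (U y) (A y), real_inner_comm (A (A y)) (U y)]
  show ν * (Δ fun z => headPressure a U P z - ⟪A z, U z⟫) y -
      fderiv ℝ (fun z => headPressure a U P z - ⟪A z, U z⟫) y (U y - A y + a • y) = _
  rw [hLap, hDer (U y - A y + a • y), hΔP y, hdiv y, hS, hspin]
  simp only [map_add, map_sub, map_smul, inner_add_left, inner_add_right, inner_sub_left,
    inner_sub_right, real_inner_smul_left, real_inner_smul_right, smul_eq_mul]
  set L : E := (Δ U : E → E) y with hL
  rw [real_inner_comm (U y) (fderiv ℝ U y y), real_inner_comm (U y) (fderiv ℝ U y (A y)),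
    real_inner_comm (U y) (fderiv ℝ U y (U y))] at hEU
  rw [real_inner_comm y L, real_inner_comm y (U y), real_inner_comm y (fderiv ℝ U y y),
    real_inner_comm y (fderiv ℝ U y (A y)), real_inner_comm y (fderiv ℝ U y (U y)), h2] at hEy
  rw [real_inner_comm (A y) L, real_inner_comm (A y) (U y),
    real_inner_comm (A y) (fderiv ℝ U y y), real_inner_comm (A y) (fderiv ℝ U y (A y)),
    real_inner_comm (A y) (fderiv ℝ U y (U y)), h3] at hEAy
  linear_combination (-1 : ℝ) * hEU - a * hEy + hEAy + 2 * h1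

end Summit.NavierStokesRegularity.NavierStokesRegularity.Theorems.CorkscrewProfile.Birth
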